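import Summits.HubbardSuperconductivity.HubbardSuperconductivity.Theorems.AnisotropyChordTransferRotatedPackage
import Summits.HubbardSuperconductivity.HubbardSuperconductivity.Theorems.AnisotropyChordTransferLadderBound

/-!
# H0 rotor rung, route (1): LEMMA X₀ˢ — the spin-flip sharpening of the tower excess at half filling
(Verbatim port of the theory seat `hubbard-h0-rotor-theory-1` file `cycle15/lean/PartN15.lean`, sha16 b77d81383c9dbe28, by the prover seat
`hubbard-h0-rotor-p1` g18: tree namespace, linter option and docstring tags only; no new mathematics.)

Theory seat `hubbard-h0-rotor-theory-1` g15 (memo ROTOR-THEORY-15 §200).  For `H(Δ) = xxzHamiltonian 1 (torusGraph 2 L) (−1) Δ`,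
`Δ ≤ 1`, and the sector-`0` Perron amplitude `a₀`:

* `lowerSum_flipAll`, `lowerNormSq_eq_raiseNormSq_flip`, `energyQ_comp_flipAll`, `energyQ_lowerSum_eq_flip`: particle–hole
  bookkeeping `S⁻_tot = F S⁺_tot F` at the amplitude level (any real amplitude, any `L`);
* `raiseExcess_zero_le` (**LEMMA X₀ˢ**): `⟨S⁺a₀, H S⁺a₀⟩ − E(0)‖S⁺a₀‖² ≤ 2(1−Δ)L²` — half of LEMMA E's `4(1−Δ)L²`, because at
  `M = 0` the raise and lower excesses coincide (`a₀ ∘ flipAll = a₀`, tree `perron_zero_comp_flipAll`);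
* `templeNumerator_zero_le` and `templeNumerator_zero_le_of_charging` (**LEMMA X₀ᴷ**): the Temple numerator of the link `0 → 1`
  is `≤ 2(1−Δ)L² − (E(1)−E(0))‖S⁺a₀‖²`, and `≤ (2(1−Δ) − c₀/(2κ₁))·L²` under the charging lower bound `E(1) − E(0) ≥ 1/(2κ₁L²)`
  and the anchor `‖S⁺a₀‖² ≥ c₀L⁴`.

All folklore given the tree's LEMMA E (`ladderExcessBound_holds`).
-/

set_option linter.dupNamespace false
set_option autoImplicit false

noncomputable section

open Finset Matrix
open scoped ComplexOrder
open Literature.MathematicalPhysics.QuantumLattice Literature.MathematicalPhysics.QuantumLattice.SpinOperators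
open Literature.Probability.LatticeModels
open Summit.HubbardSuperconductivity.HubbardSuperconductivity.Theorems.AnisotropyChord.InsertionEntropy
open Summit.HubbardSuperconductivity.HubbardSuperconductivity.Theorems.AnisotropyChord.Tower

namespace Summit.HubbardSuperconductivity.HubbardSuperconductivity.Theorems.AnisotropyChord.Transfer

section FlipBookkeeping

variable {V : Type} [Fintype V] [DecidableEq V]

omit [Fintype V] in
/-- flipping after adding a particle at `x` = removing it after flipping. [folklore] -/
theorem flipAll_update_one (σ : V → Fin 2) (x : V) :
    flipAll (Function.update σ x 1) = Function.update (flipAll σ) x 0 := by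
  funext y
  simp only [flipAll, Function.update_apply]
  split_ifs with h
  · decide
  · rfl

omit [Fintype V] [DecidableEq V] in
/-- `(flipAll σ) x = 1 ↔ σ x = 0`. [folklore] -/
theorem flipAll_eq_one_iff (σ : V → Fin 2) (x : V) : flipAll σ x = 1 ↔ σ x = 0 := by
  have h := flipAll_eq_zero_iff (flipAll σ) x
  rw [flipAll_flipAll] at h
  exact h.symm

/-- **`S⁻_tot = F S⁺_tot F` on real amplitudes:** `(S⁻ a)(Fσ) = (S⁺ (a ∘ F))(σ)`. [folklore] -/
theorem lowerSum_flipAll (a : (V → Fin 2) → ℝ) (σ : V → Fin 2) :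
    lowerSum a (flipAll σ) = raiseSum (a ∘ flipAll) σ := by
  unfold lowerSum raiseSum
  refine Finset.sum_congr rfl fun x _ => ?_
  simp only [flipAll_eq_one_iff, Function.comp_apply, flipAll_update_one]

/-- `‖S⁻ a‖² = ‖S⁺ (a ∘ F)‖²`. [folklore] -/
theorem lowerNormSq_eq_raiseNormSq_flip (a : (V → Fin 2) → ℝ) :
    lowerNormSq a = raiseNormSq (a ∘ flipAll) := by
  unfold lowerNormSq raiseNormSq
  rw [← sum_flipAll (fun τ => lowerSum a τ ^ 2)]
  refine Finset.sum_congr rfl fun σ _ => ?_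
  rw [lowerSum_flipAll]

/-- `S⁻ a = (S⁺ (a ∘ F)) ∘ F` as functions. [folklore] -/
theorem lowerSum_eq_raiseSum_flip_comp (a : (V → Fin 2) → ℝ) :
    lowerSum a = (raiseSum (a ∘ flipAll)) ∘ flipAll := by
  funext τ
  have h := lowerSum_flipAll a (flipAll τ)
  rw [flipAll_flipAll] at h
  simpa only [Function.comp_apply] using h

end FlipBookkeeping

section Torus

variable {L : ℕ} [NeZero L]

/-- the quadratic form `⟨φ, Hφ⟩` is invariant under the global flip. [folklore] -/
theorem energyQ_comp_flipAll (Δ : ℝ) (b : TensorIndex (TorusSite 2 L) 2 → ℝ) :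
    energyQ L Δ (b ∘ flipAll) = energyQ L Δ b := by
  rw [energyQ_eq_real, energyQ_eq_real, energy_flipAll]
  have hu : ∑ σ, (b ∘ flipAll) σ ^ 2 = ∑ σ, b σ ^ 2 := by
    simp only [Function.comp_apply]
    exact sum_flipAll (fun τ => b τ ^ 2)
  rw [hu]

/-- `⟨S⁻a, H S⁻a⟩ = ⟨S⁺(a∘F), H S⁺(a∘F)⟩`. [folklore] -/
theorem energyQ_lowerSum_eq_flip (Δ : ℝ) (a : TensorIndex (TorusSite 2 L) 2 → ℝ) :
    energyQ L Δ (lowerSum a) = energyQ L Δ (raiseSum (a ∘ flipAll)) := by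
  rw [lowerSum_eq_raiseSum_flip_comp, energyQ_comp_flipAll]

/-- **LEMMA X₀ˢ (raise excess at half filling, flip-sharpened):** for the sector-`0` Perron amplitude,
`⟨S⁺a₀, H S⁺a₀⟩ − E(0)‖S⁺a₀‖² ≤ 2(1−Δ)L²`. [folklore] -/
theorem raiseExcess_zero_le {Δ : ℝ} (hΔ : Δ ≤ 1) {a₀ : TensorIndex (TorusSite 2 L) 2 → ℝ}
    (ha₀ : IsPerronSectorGroundAmplitude L Δ 0 a₀) :
    energyQ L Δ (raiseSum a₀) - sectorE L Δ 0 * raiseNormSq a₀ ≤ 2 * (1 - Δ) * (L : ℝ) ^ 2 := by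
  have hflip : a₀ ∘ flipAll = a₀ := perron_zero_comp_flipAll L ha₀
  have hE := ladderExcessBound_holds L Δ 0 hΔ a₀ ha₀
  have h1 : energyQ L Δ (lowerSum a₀) = energyQ L Δ (raiseSum a₀) := by
    rw [energyQ_lowerSum_eq_flip, hflip]
  have h2 : lowerNormSq a₀ = raiseNormSq a₀ := by
    rw [lowerNormSq_eq_raiseNormSq_flip, hflip]
  rw [h1, h2] at hE
  linarith

/-- **Temple numerator of the link `0 → 1`, flip-sharpened:**
`⟨S⁺a₀, H S⁺a₀⟩ − E(1)‖S⁺a₀‖² ≤ 2(1−Δ)L² − (E(1) − E(0))‖S⁺a₀‖²`. [folklore] -/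
theorem templeNumerator_zero_le {Δ : ℝ} (hΔ : Δ ≤ 1) {a₀ : TensorIndex (TorusSite 2 L) 2 → ℝ}
    (ha₀ : IsPerronSectorGroundAmplitude L Δ 0 a₀) :
    energyQ L Δ (raiseSum a₀) - sectorE L Δ 1 * raiseNormSq a₀
      ≤ 2 * (1 - Δ) * (L : ℝ) ^ 2 - (sectorE L Δ 1 - sectorE L Δ 0) * raiseNormSq a₀ := by
  have h := raiseExcess_zero_le hΔ ha₀
  linarith

/-- **LEMMA X₀ᴷ (the TARGET's (K′) made load-bearing):** under the charging lower bound `E(1) − E(0) ≥ 1/(2κ₁L²)` and the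
anchor `‖S⁺a₀‖² ≥ c₀L⁴`, the Temple numerator of the link `0 → 1` is `≤ (2(1−Δ) − c₀/(2κ₁))·L²`. [folklore] -/
theorem templeNumerator_zero_le_of_charging {Δ κ₁ c₀ : ℝ} (hΔ : Δ ≤ 1) (hκ : 0 < κ₁) (hc₀ : 0 ≤ c₀)
    {a₀ : TensorIndex (TorusSite 2 L) 2 → ℝ} (ha₀ : IsPerronSectorGroundAmplitude L Δ 0 a₀)
    (hK : 1 / (2 * κ₁ * (L : ℝ) ^ 2) ≤ sectorE L Δ 1 - sectorE L Δ 0)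
    (hN : c₀ * (L : ℝ) ^ 4 ≤ raiseNormSq a₀) :
    energyQ L Δ (raiseSum a₀) - sectorE L Δ 1 * raiseNormSq a₀
      ≤ (2 * (1 - Δ) - c₀ / (2 * κ₁)) * (L : ℝ) ^ 2 := by
  have hL : 0 < (L : ℝ) := Nat.cast_pos.mpr (Nat.pos_of_ne_zero (NeZero.ne L))
  have hL2 : 0 < (L : ℝ) ^ 2 := by positivity
  have h := templeNumerator_zero_le hΔ ha₀
  have hpos : 0 < 1 / (2 * κ₁ * (L : ℝ) ^ 2) := by positivity
  have hμ : 0 ≤ sectorE L Δ 1 - sectorE L Δ 0 := le_trans hpos.le hK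
  have hN0 : 0 ≤ c₀ * (L : ℝ) ^ 4 := by positivity
  have hprod : 1 / (2 * κ₁ * (L : ℝ) ^ 2) * (c₀ * (L : ℝ) ^ 4)
      ≤ (sectorE L Δ 1 - sectorE L Δ 0) * raiseNormSq a₀ :=
    mul_le_mul hK hN hN0 hμ
  have hsimp : 1 / (2 * κ₁ * (L : ℝ) ^ 2) * (c₀ * (L : ℝ) ^ 4) = c₀ / (2 * κ₁) * (L : ℝ) ^ 2 := by
    field_simp
  rw [hsimp] at hprod
  nlinarith [hprod, h]

end Torus

end Summit.HubbardSuperconductivity.HubbardSuperconductivity.Theorems.AnisotropyChord.Transfer
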